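import Summits.QuantumFields.BalabanUV.T4Continuum.Spine.NE1p.DressedSmallFieldGeometry
import Summits.QuantumFields.BalabanUV.T4Continuum.Spine.NE1p.DressedTableOfBirths

/-!
# T⁴ programme, spine estimate NE1′ (node O3b/H2) — THE REMAINING SMALL-FIELD FACES ON THE POLYMER GEOMETRY OF RECORD: the
# (w5) ∕ response ∕ (2.14)-shape ∕ births ENDs over a `B13Resummation.Geometry` bundle and at the CONSTRUCTED torus geometry
# `tgeometry 4 N` with the clauses (B5) LOCATED as numerals; (B5) as located is satisfiable (crew row S24)

Cell `pub-balaban`, sub-cell `t4`, BINDER-OWNERS row NE1′ (owner lineage t4-ne1p-p1); NE1′ formalisation crew seat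
`b2b-balaban-t4-ne1p-formalise-leaf-01` (LEAF PROVER 01, generation 9), crew row S24 (typer R-T93 (v); DAG N29z) = the COMPLEMENT of
the owner's N0o `Spine/NE1p/DressedSmallFieldGeometry` (p221125): the (B4)-discharge-by-name was typed independently by this seat
(INTENT `CLAIMS.log` 2026-08-20 14:30:33Z, staged 14:38Z) and by the owner (N0o, 14:39Z); the owner's first refusal («NOT THIS SHAPE» at
N0o's path, «GO» for the complement under this name, 14:41:57Z) and the typer's booking fix the split.  ADDITIVE — imports N0o
`DressedSmallFieldGeometry` (⇒ N0m, N0j, pv22 `TreeLengthTorusGeometry`) and N0l `DressedTableOfBirths` (p220539 ∕ p220630; ⇒ N0k)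
ONLY; THEOREMS ONLY (0 `def`, 0 `def … : Prop`); nothing of N0o is restated.  v1.1 (generation 10, DOC-ONLY; cross-read X106 ∕
typer R-T98 (i)): the docstring of §1 `muPart_locE_le_of_births_geometry` no longer says «(B4) discharged» over the ABSTRACT bundle `G`
— (B4) is BUNDLED there and discharged only at `tgeometry 4 N` (§2); every declaration byte-identical to v1 (p221652).

WHY THIS FILE.  N0o wires FOUR small-field faces over a proved polymer geometry (`muPart_locE_le_geom`, `norm_locE_le_geom`,
`differentiableOn_locE_geom`, `attachedPart_locE_le_geom`) and ONE on the torus (`muPart_locE_le_torus`, symbolic constants).  The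
other ENDs of the owner's generation-26 kernel still DISPLAY the thirteen geometry ∕ sign sockets `hloc` `hreach` `hd` `hK₀` `hc₁` `hν`
`hκ₀` `hc` `hb` `h126` `hvol` `h227` `hX` (= binder group (B4)).  THIS FILE wires them, nothing else:
* §1 over ONE `G : B13Resummation.Geometry D Cube` (unit pv18's HYPOTHESIS structure; composition = `cammarotaStepWith_of_KP`
  l.478–484, at a footprint `X := G.cubes X₀`, `dX := D.dj X₀`, print's (2.27) constant `c = 5`, `b = 5·r₁`), with EXPLICIT
  instance binders `[DecidableEq D.Dom] [DecidableRel G.ι]` (so any consumer's instances unify): N0j `regenPart_locE_le` ((w5) with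
  decay) and `muDeriv_locE_le` (linear response — the face feeding `DressedSmallFieldAllowance`), N0k `muPart_locE_le_of_rep`
  ((2.14)-shape), N0l `muPart_locE_le_of_births` (births — the END with (B2) already discharged).
* §2 at the CONSTRUCTED torus geometry `TreeLengthTorusGeometry.tgeometry 4 N` (pv22; 𝐃_{k+1} = `tsys 4 N`, d_{k+1} = `torusTreeLen`,
  incompatibility `TTouch`; all `Geometry` fields PROVED there) with the constants LOCATED AS NUMERALS in the statements (N0o
  `torus_consts` + `K₀_four`: ν = 9, κ₀ = 64·log 162, c₁ = 64, K₀ = `B12TreeDecay.K₀ 64 8`; clauses `r₁ + 2·(64·log 162) + 2 ≤ R`,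
  `A·e^{5r₁+1}·K₀(64,8)·9·64 ≤ 1`; envelope `e·9·64·K₀(64,8)²·A·e^{−r₁·torusTreeLen X₀}`): `norm_locE_le_torus`, `differentiableOn_locE_torus`
  (from N0o's `…_geom` faces), `regenPart_locE_le_torus`, `muDeriv_locE_le_torus`, `muPart_locE_le_of_rep_torus`,
  `muPart_locE_le_of_births_torus` (from §1) — NO geometry hypothesis in any of them.
* §3 `torusClauses_nonvacuous`: the located clauses are jointly satisfiable with a POSITIVE dressed constant (r₁ = 0,
  R = 2·(64·log 162) + 2, A = (e·K₀(64,8)·9·64)⁻¹, smallness with EQUALITY) — (B5) as located is not contradictory.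

WHAT STAYS DISPLAYED (binders, by name; NOTHING instantiated on Bałaban's densities): (B1) `hrep` (N0k ∕ N0l — the owner's READING of
[Balaban1988RGII] Lemma 1 (1.33)) ∕ (E1)(E2) `hhol` ∕ `hm` (N0j); (B3) `hL3` — ONE (2.38)-SHAPE inequality at the dressed constant (= GAPS
G-ne9p2-5, shared with NE9; a BINDER, never `[cite:`-tagged); `hA`, `hr₁`, the two located clauses, the source window ∕ strength
radius; N0l's births ∕ map binders and the measurability ∕ integrability sockets verbatim.  (B5) is LOCATED and NON-VACUOUS — not
discharged against print's numbers.
HONEST FRAMING.  Kernel bookkeeping — displayed sockets replaced by the tree's CONSTRUCTED torus geometry BY NAME and two numeric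
clauses; the identification of `tsys 4 N` ∕ `torusTreeLen` with print's 𝐃_{k+1} ∕ d_{k+1} is pv22's READING (DIVERGENCE D-pv22.3),
not asserted here; printed loci ([Balaban1988RGII] (2.11) p. 14, (1.26) p. 8, (2.27) ∕ (2.30) p. 18, (2.38) p. 20, (2.39)–(2.41) p. 21;
[Balaban1987RGI] p. 251, p. 257) are TYPE ∕ CONTEXT through the imported [cite]-tagged Literature modules, re-asserted nowhere;
ABSOLUTE RULE honoured ([folklore] kernel lemmas only).  NE1′ ⇐ the named binders — NOT printed, NOT proved; 0 leaves instantiated on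
Bałaban's densities; spine PROVED 0∕9; count 9 unchanged.  Rung (B)+1 on ONE finite four-torus — NOT infinite volume, NOT a mass gap,
NOT OS on ℝ⁴, NOT Clay.  HONEST DEPENDENCY: continuum YM on T⁴ ⇐ BetaPertH ∧ nine spine estimates (0/9 proved); BetaPertH ⇐ (D1) ∧
(D4) ∧ CAP+tail; G-an2-4 gates asym, D1 and NE2/3/4.
-/

noncomputable section
namespace Summit.QuantumFields.BalabanUV.T4Continuum.NE1p.DressedSmallFieldGeometryFaces
open MeasureTheory Metric Set Complex
open scoped BigOperators
open Literature.MathematicalPhysics.QuantumFieldTheory.Balaban1983to89 (LocDomainSys)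
open Literature.MathematicalPhysics.QuantumFieldTheory.Balaban1983to89.B13Resummation (locE Geometry)
open Literature.MathematicalPhysics.QuantumFieldTheory.Balaban1983to89.TreeLengthTorus (TPt TDom tsys torusTreeLen)
open Literature.MathematicalPhysics.QuantumFieldTheory.Balaban1983to89.TreeLengthTorusGeometry (TTouch tgeometry)
open Literature.MathematicalPhysics.QuantumFieldTheory.Balaban1983to89.B12TreeDecay (K₀)
open Summit.QuantumFields.BalabanUV.T4Continuum.NE1p.DressedSmallFieldPencil (regenPart_locE_le muDeriv_locE_le)
open Summit.QuantumFields.BalabanUV.T4Continuum.NE1p.DressedSmallFieldShape (muPart_locE_le_of_rep)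
open Summit.QuantumFields.BalabanUV.T4Continuum.NE1p.DressedTableOfBirths (muPart_locE_le_of_births)
open Summit.QuantumFields.BalabanUV.T4Continuum.NE1p.DressedSmallFieldGeometry (norm_locE_le_geom differentiableOn_locE_geom
  torus_consts)

/-! ## §1 THE REMAINING FACES OVER A `B13Resummation.Geometry` BUNDLE — thirteen sockets ↦ one bundle, explicit instances -/
section OfGeometry
variable {D : LocDomainSys} {Cube : Type} [DecidableEq Cube] [DecidableEq D.Dom] (G : Geometry D Cube) [DecidableRel G.ι]

/-- **THE STRENGTH PENCIL = THE REGENERATION CONSTANT (w5) WITH DECAY, OVER A POLYMER GEOMETRY** (kernel; N0j `regenPart_locE_le` BY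
NAME, its geometry ∕ sign sockets fed from `G`'s fields at the footprint `G.cubes X₀`, `c = 5`, `b = 5·r₁`): dressed activities
complex differentiable in a strength parameter on `‖s‖ < ϱ`, `1 < ϱ`, under a strength-free (2.38)-shape majorant (`hL3`, a BINDER)
⇒ `‖E_1(X₀) − E_0(X₀)‖ ≤ (e·G.ν·G.c₁·G.K₀²·A·e^{−r₁ d(X₀)})/(ϱ − 1)`. [folklore] -/
theorem regenPart_locE_le_of_geometry {m : D.Dom → ℝ} {act : ℂ → D.Dom → ℂ} {A R r₁ ϱ : ℝ} (X₀ : D.Dom)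
    (hA : 0 ≤ A) (hr₁ : 0 ≤ r₁) (hrate : r₁ + 2 * G.κ₀ + 2 ≤ R)
    (hsmall : A * Real.exp (5 * r₁ + 1) * G.K₀ * G.ν * G.c₁ ≤ 1)
    (hhol : ∀ Z, G.cubes Z ⊆ G.cubes X₀ → DifferentiableOn ℂ (fun s => act s Z) (ball (0 : ℂ) ϱ))
    (hm : ∀ s ∈ ball (0 : ℂ) ϱ, ∀ Z, G.cubes Z ⊆ G.cubes X₀ → ‖act s Z‖ ≤ m Z)
    (hL3 : ∀ Z, G.cubes Z ⊆ G.cubes X₀ → m Z ≤ A * Real.exp (-(R * D.dj Z))) (hϱ : 1 < ϱ) :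
    ‖locE G.ι G.cubes (act 1) (G.cubes X₀) - locE G.ι G.cubes (act 0) (G.cubes X₀)‖ ≤
      Real.exp 1 * G.ν * G.c₁ * G.K₀ ^ 2 * A * Real.exp (-(r₁ * D.dj X₀)) / (ϱ - 1) := by
  haveI : Std.Refl G.ι := ⟨G.ι_refl⟩
  haveI : Std.Symm G.ι := ⟨G.ι_symm⟩
  exact regenPart_locE_le G.ι (c := 5) (b := 5 * r₁) G.loc G.reach_le D.dj_nonneg hA G.K₀_nonneg G.c₁_nonneg
    G.ν_nonneg G.κ₀_nonneg hr₁ (by norm_num) (le_of_eq (by ring)) G.ineq126 G.volBound (G.ineq227 X₀) hrate hsmall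
    (G.cubes_nonempty X₀) hhol hm hL3 hϱ

/-- **LINEAR RESPONSE OF THE DRESSED SMALL-FIELD OUTPUT OVER A POLYMER GEOMETRY** (kernel; N0j `muDeriv_locE_le` BY NAME — the face
feeding `DressedSmallFieldAllowance` — geometry ∕ sign sockets from `G`): on `‖μ‖ ≤ μ₀ < μ₁` the source-derivative of `E_s(X₀)` is
`≤ 2·(e·G.ν·G.c₁·G.K₀²·A·e^{−r₁ d(X₀)})/(μ₁ − μ₀)`. [folklore] -/
theorem muDeriv_locE_le_of_geometry {m : D.Dom → ℝ} {act : ℂ → D.Dom → ℂ} {A R r₁ μ₁ μ₀ : ℝ} (X₀ : D.Dom) {μ : ℂ}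
    (hA : 0 ≤ A) (hr₁ : 0 ≤ r₁) (hrate : r₁ + 2 * G.κ₀ + 2 ≤ R)
    (hsmall : A * Real.exp (5 * r₁ + 1) * G.K₀ * G.ν * G.c₁ ≤ 1)
    (hhol : ∀ Z, G.cubes Z ⊆ G.cubes X₀ → DifferentiableOn ℂ (fun s => act s Z) (ball (0 : ℂ) μ₁))
    (hm : ∀ s ∈ ball (0 : ℂ) μ₁, ∀ Z, G.cubes Z ⊆ G.cubes X₀ → ‖act s Z‖ ≤ m Z)
    (hL3 : ∀ Z, G.cubes Z ⊆ G.cubes X₀ → m Z ≤ A * Real.exp (-(R * D.dj Z))) (h01 : μ₀ < μ₁) (hμ : ‖μ‖ ≤ μ₀) :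
    ‖deriv (fun s => locE G.ι G.cubes (act s) (G.cubes X₀)) μ‖ ≤
      2 * (Real.exp 1 * G.ν * G.c₁ * G.K₀ ^ 2 * A * Real.exp (-(r₁ * D.dj X₀))) / (μ₁ - μ₀) := by
  haveI : Std.Refl G.ι := ⟨G.ι_refl⟩
  haveI : Std.Symm G.ι := ⟨G.ι_symm⟩
  exact muDeriv_locE_le G.ι (c := 5) (b := 5 * r₁) G.loc G.reach_le D.dj_nonneg hA G.K₀_nonneg G.c₁_nonneg G.ν_nonneg
    G.κ₀_nonneg hr₁ (by norm_num) (le_of_eq (by ring)) G.ineq126 G.volBound (G.ineq227 X₀) hrate hsmall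
    (G.cubes_nonempty X₀) hhol hm hL3 h01 hμ
variable {Ω : Type*} [MeasurableSpace Ω] {J Old Pot : Type*} [NormedAddCommGroup Old] [NormedSpace ℂ Old]
  [NormedAddCommGroup Pot] [NormedSpace ℂ Pot]

/-- **THE μ-PART FROM THE (2.14)-SHAPE, OVER A POLYMER GEOMETRY** (kernel; N0k `DressedSmallFieldShape.muPart_locE_le_of_rep` BY NAME,
geometry ∕ sign sockets from `G`): the (2.14)-shape representation along a dressed table curve `V` (`hrep`, `hV`, `hVR`), ONE Lemma-3
inequality on the prefactor data at the dressed radius (`hL3`, a BINDER), the two clauses ⇒ the μ-part bound at `G.cubes X₀`. [folklore] -/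
theorem muPart_locE_le_of_rep_geometry {ν' : J → Measure Ω} {pre : J → Ω → ℂ} {lin : J → Ω → (Pot →L[ℂ] ℂ)}
    {l : J → Ω → ℝ} {R₀ : ℝ} {V : ℂ → Pot} {terms : D.Dom → Finset J} {act : ℂ → D.Dom → ℂ} {A R r₁ μ₁ μ₀ : ℝ}
    (X₀ : D.Dom) {μ : ℂ}
    (hA : 0 ≤ A) (hr₁ : 0 ≤ r₁) (hrate : r₁ + 2 * G.κ₀ + 2 ≤ R)
    (hsmall : A * Real.exp (5 * r₁ + 1) * G.K₀ * G.ν * G.c₁ ≤ 1)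
    (hrep : ∀ s ∈ ball (0 : ℂ) μ₁, ∀ Z, act s Z = ∑ j ∈ terms Z, ∫ ω, pre j ω * cexp (lin j ω (V s)) ∂(ν' j))
    (hpre : ∀ j, AEStronglyMeasurable (pre j) (ν' j))
    (hlinw : ∀ j (Q : Pot), AEStronglyMeasurable (fun ω => lin j ω Q) (ν' j)) (hl : ∀ j ω, ‖lin j ω‖ ≤ l j ω)
    (hint : ∀ j, Integrable (fun ω => ‖pre j ω‖ * Real.exp (l j ω * R₀)) (ν' j))
    (hV : DifferentiableOn ℂ V (ball (0 : ℂ) μ₁)) (hVR : MapsTo V (ball (0 : ℂ) μ₁) (ball (0 : Pot) R₀))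
    (hL3 : ∀ Z, G.cubes Z ⊆ G.cubes X₀ →
      ∑ j ∈ terms Z, ∫ ω, ‖pre j ω‖ * Real.exp (l j ω * R₀) ∂(ν' j) ≤ A * Real.exp (-(R * D.dj Z)))
    (h0 : 0 < μ₀) (h01 : μ₀ < μ₁) (hμ : ‖μ‖ ≤ μ₀) :
    ‖locE G.ι G.cubes (act μ) (G.cubes X₀) - locE G.ι G.cubes (act 0) (G.cubes X₀)‖ ≤
      Real.exp 1 * G.ν * G.c₁ * G.K₀ ^ 2 * A * Real.exp (-(r₁ * D.dj X₀)) * (μ₀ / (μ₁ - μ₀)) := by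
  haveI : Std.Refl G.ι := ⟨G.ι_refl⟩
  haveI : Std.Symm G.ι := ⟨G.ι_symm⟩
  exact muPart_locE_le_of_rep G.ι (c := 5) (b := 5 * r₁) G.loc G.reach_le D.dj_nonneg hA G.K₀_nonneg G.c₁_nonneg
    G.ν_nonneg G.κ₀_nonneg hr₁ (by norm_num) (le_of_eq (by ring)) G.ineq126 G.volBound (G.ineq227 X₀) hrate hsmall
    (G.cubes_nonempty X₀) hrep hpre hlinw hl hint hV hVR hL3 h0 h01 hμ

/-- **THE μ-PART FROM A FAMILY OF BIRTHS, OVER A POLYMER GEOMETRY** (kernel; N0l `DressedTableOfBirths.muPart_locE_le_of_births` BY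
NAME, geometry ∕ sign sockets from `G`): the dressed table `μ ↦ V₀ + T (D μ)` of births ((w1) + L-B `hDan` ∕ `hDsz`, «Lemma 1» map
bound `hT`, `hV₀`, `hw`), ONE Lemma-3 inequality at the dressed radius `ε₁ + w` (`hL3`, a BINDER), the two clauses ⇒ the μ-part bound
at `G.cubes X₀` — (B2) discharged (into the births data); (B4) BUNDLED as `G` (discharged on `tgeometry 4 N` in §2). [folklore] -/
theorem muPart_locE_le_of_births_geometry {ν' : J → Measure Ω} {pre : J → Ω → ℂ} {lin : J → Ω → (Pot →L[ℂ] ℂ)}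
    {l : J → Ω → ℝ} {T : Old →L[ℂ] Pot} {Dμ : ℂ → Old} {V₀ : Pot} {terms : D.Dom → Finset J} {act : ℂ → D.Dom → ℂ}
    {A R r₁ μ₁ μ₀ ε₁ D₀ t w : ℝ} (X₀ : D.Dom) {μ : ℂ}
    (hA : 0 ≤ A) (hr₁ : 0 ≤ r₁) (hrate : r₁ + 2 * G.κ₀ + 2 ≤ R)
    (hsmall : A * Real.exp (5 * r₁ + 1) * G.K₀ * G.ν * G.c₁ ≤ 1)
    (hrep : ∀ s ∈ ball (0 : ℂ) μ₁, ∀ Z,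
      act s Z = ∑ j ∈ terms Z, ∫ ω, pre j ω * cexp (lin j ω (V₀ + T (Dμ s))) ∂(ν' j))
    (hpre : ∀ j, AEStronglyMeasurable (pre j) (ν' j))
    (hlinw : ∀ j (Q : Pot), AEStronglyMeasurable (fun ω => lin j ω Q) (ν' j)) (hl : ∀ j ω, ‖lin j ω‖ ≤ l j ω)
    (hint : ∀ j, Integrable (fun ω => ‖pre j ω‖ * Real.exp (l j ω * (ε₁ + w))) (ν' j))
    (hDan : DifferentiableOn ℂ Dμ (ball (0 : ℂ) μ₁)) (hDsz : ∀ s ∈ ball (0 : ℂ) μ₁, ‖Dμ s‖ ≤ D₀)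
    (hV₀ : ‖V₀‖ ≤ ε₁) (hT : ‖T‖ ≤ t) (hw : t * D₀ < w)
    (hL3 : ∀ Z, G.cubes Z ⊆ G.cubes X₀ →
      ∑ j ∈ terms Z, ∫ ω, ‖pre j ω‖ * Real.exp (l j ω * (ε₁ + w)) ∂(ν' j) ≤ A * Real.exp (-(R * D.dj Z)))
    (h0 : 0 < μ₀) (h01 : μ₀ < μ₁) (hμ : ‖μ‖ ≤ μ₀) :
    ‖locE G.ι G.cubes (act μ) (G.cubes X₀) - locE G.ι G.cubes (act 0) (G.cubes X₀)‖ ≤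
      Real.exp 1 * G.ν * G.c₁ * G.K₀ ^ 2 * A * Real.exp (-(r₁ * D.dj X₀)) * (μ₀ / (μ₁ - μ₀)) := by
  haveI : Std.Refl G.ι := ⟨G.ι_refl⟩
  haveI : Std.Symm G.ι := ⟨G.ι_symm⟩
  exact muPart_locE_le_of_births G.ι (c := 5) (b := 5 * r₁) G.loc G.reach_le D.dj_nonneg hA G.K₀_nonneg G.c₁_nonneg
    G.ν_nonneg G.κ₀_nonneg hr₁ (by norm_num) (le_of_eq (by ring)) G.ineq126 G.volBound (G.ineq227 X₀) hrate hsmall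
    (G.cubes_nonempty X₀) hrep hpre hlinw hl hint hDan hDsz hV₀ hT hw hL3 h0 h01 hμ
end OfGeometry

/-! ## §2 EVERY SMALL-FIELD END ON THE TORUS OF THE PAPERS — no geometry hypothesis; (B5) located as numerals -/
section Torus
variable {N : ℕ} [NeZero N]

/-- K₀ of the d = 4 torus geometry is `B12TreeDecay.K₀ 64 8` (= e^{64 log 162}/81; complements N0o's `torus_consts`, which records
ν = 9, κ₀ = 64·log 162, c₁ = 64). [folklore] -/
theorem K₀_four : (tgeometry 4 N).K₀ = K₀ 64 8 := by
  show K₀ (4 * 2 ^ 4) (2 * 4) = K₀ 64 8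
  norm_num

open Classical in
/-- **THE SOURCE-UNIFORM (2.41) ENVELOPE ON THE TORUS — NO GEOMETRY HYPOTHESIS** (kernel; N0o `norm_locE_le_geom` at `tgeometry 4 N`,
constants located): `‖E_s(X₀)‖ ≤ e·9·64·K₀(64,8)²·A·e^{−r₁·torusTreeLen X₀}` at every `‖s‖ < μ₁`. [folklore] -/
theorem norm_locE_le_torus {m : (tsys 4 N).Dom → ℝ} {act : ℂ → (tsys 4 N).Dom → ℂ} {A R r₁ μ₁ : ℝ} (X₀ : (tsys 4 N).Dom)
    (hA : 0 ≤ A) (hr₁ : 0 ≤ r₁) (hrate : r₁ + 2 * (64 * Real.log 162) + 2 ≤ R)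
    (hsmall : A * Real.exp (5 * r₁ + 1) * K₀ 64 8 * 9 * 64 ≤ 1)
    (hm : ∀ s ∈ ball (0 : ℂ) μ₁, ∀ Z : (tsys 4 N).Dom, Z.1 ⊆ X₀.1 → ‖act s Z‖ ≤ m Z)
    (hL3 : ∀ Z : (tsys 4 N).Dom, Z.1 ⊆ X₀.1 → m Z ≤ A * Real.exp (-(R * torusTreeLen Z.1))) {s : ℂ}
    (hs : s ∈ ball (0 : ℂ) μ₁) :
    ‖locE (TTouch (d := 4) (N := N)) (fun Z : (tsys 4 N).Dom => Z.1) (act s) X₀.1‖ ≤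
      Real.exp 1 * 9 * 64 * K₀ 64 8 ^ 2 * A * Real.exp (-(r₁ * torusTreeLen X₀.1)) := by
  obtain ⟨hν, hκ, hc⟩ := torus_consts N
  have hK := K₀_four (N := N)
  have h := norm_locE_le_geom (tsys 4 N) (tgeometry 4 N) (m := m) (act := act) (R := R) (b := 5 * r₁) (X₀ := X₀) hA hr₁
    (le_of_eq (by ring)) (by rw [hκ]; exact hrate) (by rw [hK, hν, hc]; exact hsmall) hm hL3 hs
  rw [hν, hc, hK] at h
  exact h

open Classical in
/-- **HOLOMORPHY IN THE SOURCE ON THE TORUS — NO GEOMETRY HYPOTHESIS** (kernel; N0o `differentiableOn_locE_geom` at `tgeometry 4 N`,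
constants located): `s ↦ E_s(X₀)` is complex differentiable on `‖s‖ < μ₁`. [folklore] -/
theorem differentiableOn_locE_torus {m : (tsys 4 N).Dom → ℝ} {act : ℂ → (tsys 4 N).Dom → ℂ} {A R r₁ μ₁ : ℝ}
    (X₀ : (tsys 4 N).Dom)
    (hA : 0 ≤ A) (hr₁ : 0 ≤ r₁) (hrate : r₁ + 2 * (64 * Real.log 162) + 2 ≤ R)
    (hsmall : A * Real.exp (5 * r₁ + 1) * K₀ 64 8 * 9 * 64 ≤ 1)
    (hhol : ∀ Z : (tsys 4 N).Dom, Z.1 ⊆ X₀.1 → DifferentiableOn ℂ (fun s => act s Z) (ball (0 : ℂ) μ₁))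
    (hm : ∀ s ∈ ball (0 : ℂ) μ₁, ∀ Z : (tsys 4 N).Dom, Z.1 ⊆ X₀.1 → ‖act s Z‖ ≤ m Z)
    (hL3 : ∀ Z : (tsys 4 N).Dom, Z.1 ⊆ X₀.1 → m Z ≤ A * Real.exp (-(R * torusTreeLen Z.1))) :
    DifferentiableOn ℂ (fun s => locE (TTouch (d := 4) (N := N)) (fun Z : (tsys 4 N).Dom => Z.1) (act s) X₀.1)
      (ball (0 : ℂ) μ₁) := by
  obtain ⟨hν, hκ, hc⟩ := torus_consts N
  have hK := K₀_four (N := N)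
  exact differentiableOn_locE_geom (tsys 4 N) (tgeometry 4 N) (m := m) (act := act) (R := R) (b := 5 * r₁) (X₀ := X₀) hA
    hr₁ (le_of_eq (by ring)) (by rw [hκ]; exact hrate) (by rw [hK, hν, hc]; exact hsmall) hhol hm hL3

open Classical in
/-- **THE (w5) REGENERATION CONSTANT WITH DECAY ON THE TORUS — NO GEOMETRY HYPOTHESIS** (kernel; §1 `regenPart_locE_le_of_geometry` at
`tgeometry 4 N`): `‖E_1(X₀) − E_0(X₀)‖ ≤ (e·9·64·K₀(64,8)²·A·e^{−r₁·torusTreeLen X₀})/(ϱ − 1)` for the strength pencil of radius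
`1 < ϱ`. [folklore] -/
theorem regenPart_locE_le_torus {m : (tsys 4 N).Dom → ℝ} {act : ℂ → (tsys 4 N).Dom → ℂ} {A R r₁ ϱ : ℝ}
    (X₀ : (tsys 4 N).Dom)
    (hA : 0 ≤ A) (hr₁ : 0 ≤ r₁) (hrate : r₁ + 2 * (64 * Real.log 162) + 2 ≤ R)
    (hsmall : A * Real.exp (5 * r₁ + 1) * K₀ 64 8 * 9 * 64 ≤ 1)
    (hhol : ∀ Z : (tsys 4 N).Dom, Z.1 ⊆ X₀.1 → DifferentiableOn ℂ (fun s => act s Z) (ball (0 : ℂ) ϱ))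
    (hm : ∀ s ∈ ball (0 : ℂ) ϱ, ∀ Z : (tsys 4 N).Dom, Z.1 ⊆ X₀.1 → ‖act s Z‖ ≤ m Z)
    (hL3 : ∀ Z : (tsys 4 N).Dom, Z.1 ⊆ X₀.1 → m Z ≤ A * Real.exp (-(R * torusTreeLen Z.1))) (hϱ : 1 < ϱ) :
    ‖locE (TTouch (d := 4) (N := N)) (fun Z : (tsys 4 N).Dom => Z.1) (act 1) X₀.1 -
        locE (TTouch (d := 4) (N := N)) (fun Z : (tsys 4 N).Dom => Z.1) (act 0) X₀.1‖ ≤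
      Real.exp 1 * 9 * 64 * K₀ 64 8 ^ 2 * A * Real.exp (-(r₁ * torusTreeLen X₀.1)) / (ϱ - 1) := by
  obtain ⟨hν, hκ, hc⟩ := torus_consts N
  have hK := K₀_four (N := N)
  have h := regenPart_locE_le_of_geometry (tgeometry 4 N) (m := m) (act := act) (R := R) X₀ hA hr₁
    (by rw [hκ]; exact hrate) (by rw [hK, hν, hc]; exact hsmall) hhol hm hL3 hϱ
  rw [hν, hc, hK] at h
  exact h

open Classical in
/-- **LINEAR RESPONSE IN THE SOURCE ON THE TORUS — NO GEOMETRY HYPOTHESIS** (kernel; §1 `muDeriv_locE_le_of_geometry` at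
`tgeometry 4 N`): on `‖μ‖ ≤ μ₀ < μ₁` the source-derivative of `E_s(X₀)` at `μ` is
`≤ 2·(e·9·64·K₀(64,8)²·A·e^{−r₁·torusTreeLen X₀})/(μ₁ − μ₀)`. [folklore] -/
theorem muDeriv_locE_le_torus {m : (tsys 4 N).Dom → ℝ} {act : ℂ → (tsys 4 N).Dom → ℂ} {A R r₁ μ₁ μ₀ : ℝ}
    (X₀ : (tsys 4 N).Dom) {μ : ℂ}
    (hA : 0 ≤ A) (hr₁ : 0 ≤ r₁) (hrate : r₁ + 2 * (64 * Real.log 162) + 2 ≤ R)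
    (hsmall : A * Real.exp (5 * r₁ + 1) * K₀ 64 8 * 9 * 64 ≤ 1)
    (hhol : ∀ Z : (tsys 4 N).Dom, Z.1 ⊆ X₀.1 → DifferentiableOn ℂ (fun s => act s Z) (ball (0 : ℂ) μ₁))
    (hm : ∀ s ∈ ball (0 : ℂ) μ₁, ∀ Z : (tsys 4 N).Dom, Z.1 ⊆ X₀.1 → ‖act s Z‖ ≤ m Z)
    (hL3 : ∀ Z : (tsys 4 N).Dom, Z.1 ⊆ X₀.1 → m Z ≤ A * Real.exp (-(R * torusTreeLen Z.1)))
    (h01 : μ₀ < μ₁) (hμ : ‖μ‖ ≤ μ₀) :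
    ‖deriv (fun s => locE (TTouch (d := 4) (N := N)) (fun Z : (tsys 4 N).Dom => Z.1) (act s) X₀.1) μ‖ ≤
      2 * (Real.exp 1 * 9 * 64 * K₀ 64 8 ^ 2 * A * Real.exp (-(r₁ * torusTreeLen X₀.1))) / (μ₁ - μ₀) := by
  obtain ⟨hν, hκ, hc⟩ := torus_consts N
  have hK := K₀_four (N := N)
  have h := muDeriv_locE_le_of_geometry (tgeometry 4 N) (m := m) (act := act) (R := R) (μ := μ) X₀ hA hr₁
    (by rw [hκ]; exact hrate) (by rw [hK, hν, hc]; exact hsmall) hhol hm hL3 h01 hμ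
  rw [hν, hc, hK] at h
  exact h
variable {Ω : Type*} [MeasurableSpace Ω] {J Old Pot : Type*} [NormedAddCommGroup Old] [NormedSpace ℂ Old]
  [NormedAddCommGroup Pot] [NormedSpace ℂ Pot]

open Classical in
/-- **THE μ-PART FROM THE (2.14)-SHAPE ON THE TORUS — NO GEOMETRY HYPOTHESIS** (kernel; §1 `muPart_locE_le_of_rep_geometry` at
`tgeometry 4 N`): N0k's END with (B4) gone and (B5) located; displayed (B1) `hrep` + table binders `hV` ∕ `hVR`, (B3) `hL3`, clauses,
window. [folklore] -/
theorem muPart_locE_le_of_rep_torus {ν' : J → Measure Ω} {pre : J → Ω → ℂ} {lin : J → Ω → (Pot →L[ℂ] ℂ)}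
    {l : J → Ω → ℝ} {R₀ : ℝ} {V : ℂ → Pot} {terms : (tsys 4 N).Dom → Finset J} {act : ℂ → (tsys 4 N).Dom → ℂ}
    {A R r₁ μ₁ μ₀ : ℝ} (X₀ : (tsys 4 N).Dom) {μ : ℂ}
    (hA : 0 ≤ A) (hr₁ : 0 ≤ r₁) (hrate : r₁ + 2 * (64 * Real.log 162) + 2 ≤ R)
    (hsmall : A * Real.exp (5 * r₁ + 1) * K₀ 64 8 * 9 * 64 ≤ 1)
    (hrep : ∀ s ∈ ball (0 : ℂ) μ₁, ∀ Z, act s Z = ∑ j ∈ terms Z, ∫ ω, pre j ω * cexp (lin j ω (V s)) ∂(ν' j))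
    (hpre : ∀ j, AEStronglyMeasurable (pre j) (ν' j))
    (hlinw : ∀ j (Q : Pot), AEStronglyMeasurable (fun ω => lin j ω Q) (ν' j)) (hl : ∀ j ω, ‖lin j ω‖ ≤ l j ω)
    (hint : ∀ j, Integrable (fun ω => ‖pre j ω‖ * Real.exp (l j ω * R₀)) (ν' j))
    (hV : DifferentiableOn ℂ V (ball (0 : ℂ) μ₁)) (hVR : MapsTo V (ball (0 : ℂ) μ₁) (ball (0 : Pot) R₀))
    (hL3 : ∀ Z : (tsys 4 N).Dom, Z.1 ⊆ X₀.1 →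
      ∑ j ∈ terms Z, ∫ ω, ‖pre j ω‖ * Real.exp (l j ω * R₀) ∂(ν' j) ≤ A * Real.exp (-(R * torusTreeLen Z.1)))
    (h0 : 0 < μ₀) (h01 : μ₀ < μ₁) (hμ : ‖μ‖ ≤ μ₀) :
    ‖locE (TTouch (d := 4) (N := N)) (fun Z : (tsys 4 N).Dom => Z.1) (act μ) X₀.1 -
        locE (TTouch (d := 4) (N := N)) (fun Z : (tsys 4 N).Dom => Z.1) (act 0) X₀.1‖ ≤
      Real.exp 1 * 9 * 64 * K₀ 64 8 ^ 2 * A * Real.exp (-(r₁ * torusTreeLen X₀.1)) * (μ₀ / (μ₁ - μ₀)) := by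
  obtain ⟨hν, hκ, hc⟩ := torus_consts N
  have hK := K₀_four (N := N)
  have h := muPart_locE_le_of_rep_geometry (tgeometry 4 N) (act := act) (R := R) (μ := μ) X₀ hA hr₁
    (by rw [hκ]; exact hrate) (by rw [hK, hν, hc]; exact hsmall) hrep hpre hlinw hl hint hV hVR hL3 h0 h01 hμ
  rw [hν, hc, hK] at h
  exact h

open Classical in
/-- **THE μ-PART FROM A FAMILY OF BIRTHS ON THE TORUS — NO GEOMETRY HYPOTHESIS** (kernel; §1 `muPart_locE_le_of_births_geometry` at
`tgeometry 4 N`): N0l's births END with (B2) AND (B4) discharged and (B5) located; displayed (B1) `hrep`, births ∕ map binders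
`hDan` ∕ `hDsz` ∕ `hT` ∕ `hV₀` ∕ `hw`, (B3) `hL3`, clauses, window. [folklore] -/
theorem muPart_locE_le_of_births_torus {ν' : J → Measure Ω} {pre : J → Ω → ℂ} {lin : J → Ω → (Pot →L[ℂ] ℂ)}
    {l : J → Ω → ℝ} {T : Old →L[ℂ] Pot} {Dμ : ℂ → Old} {V₀ : Pot} {terms : (tsys 4 N).Dom → Finset J}
    {act : ℂ → (tsys 4 N).Dom → ℂ} {A R r₁ μ₁ μ₀ ε₁ D₀ t w : ℝ} (X₀ : (tsys 4 N).Dom) {μ : ℂ}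
    (hA : 0 ≤ A) (hr₁ : 0 ≤ r₁) (hrate : r₁ + 2 * (64 * Real.log 162) + 2 ≤ R)
    (hsmall : A * Real.exp (5 * r₁ + 1) * K₀ 64 8 * 9 * 64 ≤ 1)
    (hrep : ∀ s ∈ ball (0 : ℂ) μ₁, ∀ Z,
      act s Z = ∑ j ∈ terms Z, ∫ ω, pre j ω * cexp (lin j ω (V₀ + T (Dμ s))) ∂(ν' j))
    (hpre : ∀ j, AEStronglyMeasurable (pre j) (ν' j))
    (hlinw : ∀ j (Q : Pot), AEStronglyMeasurable (fun ω => lin j ω Q) (ν' j)) (hl : ∀ j ω, ‖lin j ω‖ ≤ l j ω)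
    (hint : ∀ j, Integrable (fun ω => ‖pre j ω‖ * Real.exp (l j ω * (ε₁ + w))) (ν' j))
    (hDan : DifferentiableOn ℂ Dμ (ball (0 : ℂ) μ₁)) (hDsz : ∀ s ∈ ball (0 : ℂ) μ₁, ‖Dμ s‖ ≤ D₀)
    (hV₀ : ‖V₀‖ ≤ ε₁) (hT : ‖T‖ ≤ t) (hw : t * D₀ < w)
    (hL3 : ∀ Z : (tsys 4 N).Dom, Z.1 ⊆ X₀.1 →
      ∑ j ∈ terms Z, ∫ ω, ‖pre j ω‖ * Real.exp (l j ω * (ε₁ + w)) ∂(ν' j) ≤ A * Real.exp (-(R * torusTreeLen Z.1)))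
    (h0 : 0 < μ₀) (h01 : μ₀ < μ₁) (hμ : ‖μ‖ ≤ μ₀) :
    ‖locE (TTouch (d := 4) (N := N)) (fun Z : (tsys 4 N).Dom => Z.1) (act μ) X₀.1 -
        locE (TTouch (d := 4) (N := N)) (fun Z : (tsys 4 N).Dom => Z.1) (act 0) X₀.1‖ ≤
      Real.exp 1 * 9 * 64 * K₀ 64 8 ^ 2 * A * Real.exp (-(r₁ * torusTreeLen X₀.1)) * (μ₀ / (μ₁ - μ₀)) := by
  obtain ⟨hν, hκ, hc⟩ := torus_consts N
  have hK := K₀_four (N := N)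
  have h := muPart_locE_le_of_births_geometry (tgeometry 4 N) (act := act) (R := R) (μ := μ) X₀ hA hr₁
    (by rw [hκ]; exact hrate) (by rw [hK, hν, hc]; exact hsmall) hrep hpre hlinw hl hint hDan hDsz hV₀ hT hw hL3 h0 h01 hμ
  rw [hν, hc, hK] at h
  exact h
/-! ## §3 THE LOCATED CLAUSES ARE JOINTLY SATISFIABLE WITH A POSITIVE DRESSED CONSTANT (non-vacuity of (B5) as located) -/

/-- **(B5) AS LOCATED IS NOT CONTRADICTORY** [folklore]: with `r₁ = 0`, `R = 2·(64·log 162) + 2` and the POSITIVE dressed constant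
`A = (e·K₀(64,8)·9·64)⁻¹` both torus clauses hold (the smallness clause with EQUALITY).  A satisfiability check of two numeric
inequalities — it says nothing about which `A`, `R`, `r₁` Bałaban's dressed activities realise (that is (B3) `hL3`, a binder). -/
theorem torusClauses_nonvacuous :
    ∃ A R r₁ : ℝ, 0 < A ∧ 0 ≤ r₁ ∧ r₁ + 2 * (64 * Real.log 162) + 2 ≤ R ∧
      A * Real.exp (5 * r₁ + 1) * K₀ 64 8 * 9 * 64 ≤ 1 := by
  have hK : 0 < K₀ 64 8 := Literature.MathematicalPhysics.QuantumFieldTheory.Balaban1983to89.B12TreeDecay.K₀_pos _ _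
  have hP : 0 < Real.exp 1 * K₀ 64 8 * 9 * 64 := by positivity
  refine ⟨(Real.exp 1 * K₀ 64 8 * 9 * 64)⁻¹, 2 * (64 * Real.log 162) + 2, 0, inv_pos.2 hP, le_rfl, by simp, le_of_eq ?_⟩
  rw [mul_zero, zero_add]
  field_simp

end Torus

end Summit.QuantumFields.BalabanUV.T4Continuum.NE1p.DressedSmallFieldGeometryFaces

end
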